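import Summits.QuantumFields.YangMills.Theorems.AllWindowsColdBoxBoxHighLineBoxLapPoincare
import Summits.QuantumFields.YangMills.Theorems.AllWindowsColdBoxBoxHighLineSmearedFPOperator

/-!
# ℓ² floors of the lattice Faddeev–Popov operator `fpOperator H U`: the (4g) hypothesis `λ·‖v‖² ≤ ‖fpOperator H U v‖²`, invertibility, `‖F⁻¹‖₂`
# (STUB-PLAN-S5U5-STEP1b §2 (4f) for `fpOperator` itself; LINE-19 S5 ⟨stmt-QuantumFields-24004⟩/⟨24335⟩, LINE-20 U5 ⟨24336⟩; closer of the 4f-L² bricks)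

Width seat `ym-line-sfw-p2-w4` (prover-ym-line-sfw-p2-w4-g27-0).  `w2`'s ✓`fpOperator_one` (`fpOperator H 1 = −(Δ_I ⊗ₖ pauliPerm)`, `…SmearedFPOperator`; `1 ⊗ₖ pauliPerm` is an isometry) composed with the interior Dirichlet floor ✓`interiorLaplacian_opFloor` (`…DirichletSlabPoincare`) and the ℓ² tools
(`…SpectralFloorTools`, `…BoxLapPoincare`), all in `fpOperator` letters so that the T-S5.4 assembly only has to `exact` them:
* **`fpOperator_one_opFloor`** — `(1/16)/H⁴ · ‖v‖² ≤ ‖fpOperator H 1 v‖²` (`H ≥ 1`); `isUnit_det_fpOperator_one`; `fpOperator_one_inv_opBound`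
  (`‖(fpOperator H 1)⁻¹ w‖² ≤ 16H⁴ · ‖w‖²`);
* **`fpOperator_opFloor_of_sub_one`** — from an operator bound `‖(fpOperator H U − fpOperator H 1)v‖² ≤ m²‖v‖²` with `0 ≤ m ≤ (1/4)/H²` (the conclusion
  shape of `w2`'s 4c-E `fpOperator_sub_one_opBound[_of_linkDefect]`, `m = 84δ = 252r` on the `r`-ball): `((1/4)/H² − m)² · ‖v‖² ≤ ‖fpOperator H U v‖²` —
  literally the hypothesis `λ·(v ⬝ᵥ v) ≤ M v ⬝ᵥ M v` of (4g) `GaussianTailBound` with `M = fpOperator H U`, `λ = ((1/4)/H² − m)²`;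
* `fpOperator_inv_of_sub_one` — for `m < (1/4)/H²`: `IsUnit (fpOperator H U).det` and `((1/4)/H² − m)²·‖(fpOperator H U)⁻¹ w‖² ≤ ‖w‖²`;
* `fpOperator_inv_pointwise_of_sub_one` — for `4H²·m < 1`: `(1 − 4H² m)² · ‖(fpOperator H U)⁻¹ w‖² ≤ ‖(fpOperator H 1)⁻¹ w‖²` for every `w` (relative,
  pointwise; Frobenius/trace of the perturbed inverse ≤ `(1 − 4H²m)⁻²` × flat, cf. the LEAD's row version ✓`…PerturbedInverseRows`).
In the route's windows `m = 252 r`, `r² = r₀² = C H²(1+log H)² s²`, so `4H²m ≲ H³ log H · s = β^{3θ−1/2+κ}·log → 0` (STEP1b §4): the hypotheses hold eventually.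

Everything proved; no definitions; standard axioms.  HONEST LABEL: an elementary glue lemma for step (1b) of the XL stubs S5/U5 of critic-PASSed DRAFT lines
on the R2ξ″ cruxes; T-S5.4 proper, S5, U5 and the items ⟨24004⟩ ⟨24335⟩ ⟨24336⟩ remain OPEN; no stub is closed by name, no crux, rung or summit is proved;
the Yang–Mills mass gap is NOT proved by this file.
-/

set_option autoImplicit false

open Finset Matrix
open scoped Kronecker
open Literature.MathematicalPhysics.QuantumLattice (LGConfig)
open Literature.Probability.LatticeModels (dirichletMatrix)

namespace Summit.QuantumFields.YangMills.Theorems.AllWindowsColdBoxBoxHighLine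

namespace SpectralFloor

variable {H : ℕ}

/-- **Operator floor of the flat Faddeev–Popov operator**: `(1/16)/H⁴ · ‖v‖² ≤ ‖fpOperator H 1 v‖²` (`λ_min(F(1)ᵀF(1)) ≥ (1/16)/H⁴`). -/
theorem fpOperator_one_opFloor (hH : 1 ≤ H) (v : ↥(interiorSites H) × Fin 3 → ℝ) :
    1 / 16 / (H : ℝ) ^ 4 * (v ⬝ᵥ v) ≤ (fpOperator H 1 *ᵥ v) ⬝ᵥ (fpOperator H 1 *ᵥ v) := by
  -- `fpOperator H 1 = −(Δ_I ⊗ₖ P)` with the signed permutation `P = pauliPerm`; `Δ_I ⊗ₖ P = (Δ_I ⊗ₖ 1)(1 ⊗ₖ P)` and `1 ⊗ₖ P` is an isometry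
  -- (the facts `Pᵀ = P`, `P² = 1` are recomputed inline by `fin_cases`, not restated).
  have hPt : pauliPermᵀ = pauliPerm := by
    ext i j; fin_cases i <;> fin_cases j <;> rfl
  have hPP : pauliPerm * pauliPerm = 1 := by
    ext i j; fin_cases i <;> fin_cases j <;> simp [pauliPerm, Matrix.mul_apply, Fin.sum_univ_three]
  have hfac : dirichletMatrix (interiorSites H) ⊗ₖ pauliPerm =
      (dirichletMatrix (interiorSites H) ⊗ₖ (1 : Matrix (Fin 3) (Fin 3) ℝ)) *
        ((1 : Matrix ↥(interiorSites H) ↥(interiorSites H) ℝ) ⊗ₖ pauliPerm) := by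
    rw [← Matrix.mul_kronecker_mul, Matrix.mul_one, Matrix.one_mul]
  have hiso : ∀ w : ↥(interiorSites H) × Fin 3 → ℝ,
      (((1 : Matrix ↥(interiorSites H) ↥(interiorSites H) ℝ) ⊗ₖ pauliPerm) *ᵥ w) ⬝ᵥ
        (((1 : Matrix ↥(interiorSites H) ↥(interiorSites H) ℝ) ⊗ₖ pauliPerm) *ᵥ w) = w ⬝ᵥ w := by
    intro w
    have key : ∀ M : Matrix (↥(interiorSites H) × Fin 3) (↥(interiorSites H) × Fin 3) ℝ,
        w ⬝ᵥ ((Mᵀ * M) *ᵥ w) = (M *ᵥ w) ⬝ᵥ (M *ᵥ w) := fun M => by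
      rw [← Matrix.mulVec_mulVec, Matrix.dotProduct_mulVec, Matrix.vecMul_transpose]
    rw [← key, ← Matrix.kroneckerMap_transpose, ← Matrix.mul_kronecker_mul, Matrix.transpose_one, Matrix.one_mul, hPt, hPP,
      Matrix.one_kronecker_one, Matrix.one_mulVec]
  have h := opFloor_kronecker_one (o := Fin 3) _ (interiorLaplacian_opFloor hH)
    (((1 : Matrix ↥(interiorSites H) ↥(interiorSites H) ℝ) ⊗ₖ pauliPerm) *ᵥ v)
  rw [hiso, Matrix.mulVec_mulVec, ← hfac] at h
  rw [fpOperator_one, Matrix.neg_mulVec, neg_dotProduct_neg]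
  exact h

/-- The flat Faddeev–Popov operator is invertible (`H ≥ 1`). -/
theorem isUnit_det_fpOperator_one (hH : 1 ≤ H) : IsUnit (fpOperator H 1).det := by
  have hH' : (1 : ℝ) ≤ H := by exact_mod_cast hH
  exact isUnit_det_of_opFloor _ (by positivity) (fpOperator_one_opFloor hH)

/-- `‖(fpOperator H 1)⁻¹ w‖² ≤ 16H⁴ · ‖w‖²` (`‖F(1)⁻¹‖₂ ≤ 4H²`). -/
theorem fpOperator_one_inv_opBound (hH : 1 ≤ H) (w : ↥(interiorSites H) × Fin 3 → ℝ) :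
    ((fpOperator H 1)⁻¹ *ᵥ w) ⬝ᵥ ((fpOperator H 1)⁻¹ *ᵥ w) ≤ 16 * (H : ℝ) ^ 4 * (w ⬝ᵥ w) := by
  have h := inv_opBound_of_opFloor _ (isUnit_det_fpOperator_one hH) (fpOperator_one_opFloor hH) w
  have hH4 : 0 < (H : ℝ) ^ 4 := by
    have : (1 : ℝ) ≤ H := by exact_mod_cast hH
    positivity
  rw [div_mul_eq_mul_div, div_le_iff₀ hH4] at h
  linarith

/-- **The (4g) hypothesis for `fpOperator H U`.**  If `‖(fpOperator H U − fpOperator H 1)v‖² ≤ m²·‖v‖²` for all `v` with `0 ≤ m ≤ (1/4)/H²`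
(`w2`'s 4c-E: `m = 84δ`, `= 252r` on the `r`-ball), then `((1/4)/H² − m)² · ‖v‖² ≤ ‖fpOperator H U v‖²` for all `v`. -/
theorem fpOperator_opFloor_of_sub_one (hH : 1 ≤ H) (U : LGConfig 4 SU2) {m : ℝ} (hm : 0 ≤ m) (hmH : m ≤ 1 / 4 / (H : ℝ) ^ 2)
    (hE : ∀ v : ↥(interiorSites H) × Fin 3 → ℝ,
      ((fpOperator H U - fpOperator H 1) *ᵥ v) ⬝ᵥ ((fpOperator H U - fpOperator H 1) *ᵥ v) ≤ m ^ 2 * (v ⬝ᵥ v))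
    (v : ↥(interiorSites H) × Fin 3 → ℝ) :
    (1 / 4 / (H : ℝ) ^ 2 - m) ^ 2 * (v ⬝ᵥ v) ≤ (fpOperator H U *ᵥ v) ⬝ᵥ (fpOperator H U *ᵥ v) := by
  have hH' : (H : ℝ) ≠ 0 := by
    have : (1 : ℝ) ≤ H := by exact_mod_cast hH
    positivity
  have hA : ∀ w : ↥(interiorSites H) × Fin 3 → ℝ,
      (1 / 4 / (H : ℝ) ^ 2) ^ 2 * (w ⬝ᵥ w) ≤ (fpOperator H 1 *ᵥ w) ⬝ᵥ (fpOperator H 1 *ᵥ w) := by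
    intro w
    have he : (1 / 4 / (H : ℝ) ^ 2) ^ 2 = 1 / 16 / (H : ℝ) ^ 4 := by
      field_simp; ring
    rw [he]
    exact fpOperator_one_opFloor hH w
  have h := opFloor_add (fpOperator H 1) (fpOperator H U - fpOperator H 1) hm hmH hA hE v
  rwa [add_sub_cancel] at h

/-- … hence, for `m < (1/4)/H²`, `fpOperator H U` is invertible with `((1/4)/H² − m)² · ‖(fpOperator H U)⁻¹ w‖² ≤ ‖w‖²`
(`‖F(U)⁻¹‖₂ ≤ ((1/4)/H² − m)⁻¹`, the `‖(fpOperator H U)⁻¹‖₂ ≤ C H²` clause of STEP1b §2 (4f)). -/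
theorem fpOperator_inv_of_sub_one (hH : 1 ≤ H) (U : LGConfig 4 SU2) {m : ℝ} (hm : 0 ≤ m) (hmH : m < 1 / 4 / (H : ℝ) ^ 2)
    (hE : ∀ v : ↥(interiorSites H) × Fin 3 → ℝ,
      ((fpOperator H U - fpOperator H 1) *ᵥ v) ⬝ᵥ ((fpOperator H U - fpOperator H 1) *ᵥ v) ≤ m ^ 2 * (v ⬝ᵥ v)) :
    IsUnit (fpOperator H U).det ∧
      ∀ w : ↥(interiorSites H) × Fin 3 → ℝ,
        (1 / 4 / (H : ℝ) ^ 2 - m) ^ 2 * (((fpOperator H U)⁻¹ *ᵥ w) ⬝ᵥ ((fpOperator H U)⁻¹ *ᵥ w)) ≤ w ⬝ᵥ w := by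
  have hfl := fpOperator_opFloor_of_sub_one hH U hm hmH.le hE
  have hc : 0 < (1 / 4 / (H : ℝ) ^ 2 - m) ^ 2 := by
    have : 0 < 1 / 4 / (H : ℝ) ^ 2 - m := sub_pos.2 hmH
    positivity
  have hU := isUnit_det_of_opFloor _ hc hfl
  exact ⟨hU, inv_opBound_of_opFloor _ hU hfl⟩

/-- **Relative, pointwise**: for `4H²·m < 1`, `(1 − 4H² m)² · ‖(fpOperator H U)⁻¹ w‖² ≤ ‖(fpOperator H 1)⁻¹ w‖²` for every `w`
(so every column norm, the Frobenius norm and `tr((FᵀF)⁻¹)`-type sums of the perturbed inverse are at most `(1 − 4H²m)⁻²` times the flat ones). -/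
theorem fpOperator_inv_pointwise_of_sub_one (hH : 1 ≤ H) (U : LGConfig 4 SU2) {m : ℝ} (hm : 0 ≤ m) (hmH : 4 * (H : ℝ) ^ 2 * m < 1)
    (hE : ∀ v : ↥(interiorSites H) × Fin 3 → ℝ,
      ((fpOperator H U - fpOperator H 1) *ᵥ v) ⬝ᵥ ((fpOperator H U - fpOperator H 1) *ᵥ v) ≤ m ^ 2 * (v ⬝ᵥ v)) :
    IsUnit (fpOperator H U).det ∧
      ∀ w : ↥(interiorSites H) × Fin 3 → ℝ,
        (1 - 4 * (H : ℝ) ^ 2 * m) ^ 2 * (((fpOperator H U)⁻¹ *ᵥ w) ⬝ᵥ ((fpOperator H U)⁻¹ *ᵥ w)) ≤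
          ((fpOperator H 1)⁻¹ *ᵥ w) ⬝ᵥ ((fpOperator H 1)⁻¹ *ᵥ w) := by
  have hH' : (1 : ℝ) ≤ H := by exact_mod_cast hH
  have hinv : ∀ w : ↥(interiorSites H) × Fin 3 → ℝ,
      ((fpOperator H 1)⁻¹ *ᵥ w) ⬝ᵥ ((fpOperator H 1)⁻¹ *ᵥ w) ≤ (4 * (H : ℝ) ^ 2) ^ 2 * (w ⬝ᵥ w) := by
    intro w
    have h := fpOperator_one_inv_opBound hH w
    nlinarith
  have h := inv_add_pointwise_le (fpOperator H 1) (fpOperator H U - fpOperator H 1) (isUnit_det_fpOperator_one hH)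
    (by positivity) hm hmH hinv hE
  rwa [add_sub_cancel] at h

end SpectralFloor

end Summit.QuantumFields.YangMills.Theorems.AllWindowsColdBoxBoxHighLine
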